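import Literature.NumberTheory.GaloisCohomology.Howard2004.DVRKolyvaginBound
import HarnessLib

/-!
# Howard 2004, Lemma 1.3.3 (the part used by Thm. 1.6.1) — the ALGEBRA: no fixed vectors by dévissage,
# level-ring arithmetic, and `T̄^{Γ_K} = 0` from H.0–H.1 (theorems only)

Topic `NumberTheory/GaloisCohomology/Howard2004` (sequel to `DVRKolyvaginBound` / `DVRKolyvaginBoundProofs`).
THEOREMS ONLY: no definition, no named fact, no instance, no notation, no `sorry`.

WHY.  The tree's reduction of Howard's Thm. 1.6.1 (`Howard2004.thm161_dvrKolyvaginBound`, print leaf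
G87 of the INPUTS list; `DVRKolyvaginBoundProofs.lean` §H/§I,
`DVRSetting.exists_isFreeRankOneOn_of_printedInputs'` / `…_length_le_of_printedInputs`) takes THREE printed
inputs as hypotheses; the first of them, «Lemma 1.3.3, the part used» — `H¹(inc_k)` maps `H¹_F(K, T^{(k)})`
into `H¹_F(K, T^{(k+1)})` INJECTIVELY — is in fact a consequence of Hypotheses H.0–H.1 and the exactness
of the tower, and is PROVED in the sequel `DVRLevelRaisingInjectiveProofs.lean`.  This file supplies the
pure algebra of that proof, free of Galois cohomology:

* §1 `LevelRaising.exists_eq_pow_smul_of_forall_sub_eq_pow_smul` — DÉVISSAGE: if no vector is fixed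
  modulo `π` (residually) and `ker(π^i) ⊆ πV` below the level, then no vector is fixed modulo `π^n`
  («`H⁰(T̄) = 0 ⇒ H⁰(T/𝔪^n T) = 0`», the cokernel of `inc_k` being `T/𝔪^{e_{k+1}-e_k}`);
* §2 `LevelRaising.exists_eq_pow_mul_of_pow_mul_eq_zero`, `…_smul_…` — arithmetic of the level rings
  `R_j = R/𝔪^{e_j}` and of free `R_j`-modules: `π^i v = 0, i ≤ e ⇒ v ∈ π^{e-i} V`;
  `algebraMap_mem_nonunits`, `exists_eq_smul_of_mem_maximalIdeal_smul` — `𝔪_{R_j} = (π̄)`;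
* §3 `LevelRaising.residual_fixed_eq_zero` — **`T̄^{Γ_K} = 0`** from H.0 (free of rank two) and H.1
  (no proper stable submodule of the residual presentation): a fixed line would make `T̄` cyclic.

Print: B. Howard, Compositio Math. 140 (2004), Lemma 1.3.3 («Suppose `S` … then `H¹_F(K, S[𝔪^i]) →
H¹_F(K, S)[𝔪^i]` is an isomorphism», arXiv:1202.6340 Lemma 2.3.3, p. 7 L152–160, citing Mazur–Rubin,
Lemma 3.5.4), used at p. 12 L36–46 of the proof of Thm. 1.6.1 through «the injectivity of
`H¹_F(K,T)/𝔪^k → H¹_F(K, T^{(k)})`».  HONEST FRAMING: `thm161_dvrKolyvaginBound` is NOT proved by this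
file or its sequel (conclusion (ii) and the printed inputs Thm. 1.4.2/Prop. 1.5.5, Lemma 1.6.4 remain);
no summit statement is proved; the Birch–Swinnerton-Dyer conjecture is not proved by any of this.

References: [Howard2004HeegnerKolyvagin] B. Howard, *The Heegner point Kolyvagin system*, Compositio
Math. 140 (2004) 1439–1472, §1.3 H.0–H.1, Lemma 1.3.3, §1.6 (arXiv:1202.6340 p. 7, p. 11–12);
[MazurRubinMemoirs2004] B. Mazur, K. Rubin, *Kolyvagin systems*, Mem. AMS 799 (2004), Lemma 3.5.4;
[SerreLocalFields1979] J.-P. Serre, *Local Fields*, GTM 67, I §2 (discrete valuation rings).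
-/

set_option autoImplicit false

noncomputable section

open scoped Pointwise

namespace Literature.NumberTheory.GaloisCohomology.Howard2004.LevelRaising

/-! ## §1 Dévissage of fixed vectors -/

section Devissage

variable {R V : Type*} [CommRing R] [AddCommGroup V] [Module R V]

/-- **Dévissage of fixed vectors.**  Let `π ∈ R` act on the `R`-module `V` together with a family of
`R`-homogeneous operators `γ_i` (the Galois action).  If (F) a vector fixed by every `γ_i` modulo `πV`
lies in `πV` («`(V/πV)^Γ = 0`», the residual hypothesis) and (K) `ker (π^i ·) ⊆ πV` for `i < d` (the
level is «free over `R/π^d`»), then for every `n ≤ d` a vector fixed modulo `π^n V` lies in `π^n V`.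
This is the algebra of «`H⁰(K, T/𝔪^d T) = 0` from `H⁰(K, T̄) = 0`» (the step behind the injectivity in
Howard's Lemma 1.3.3 = Mazur–Rubin's Lemma 3.5.4). [cite: Howard2004HeegnerKolyvagin, Lemma 1.3.3 and H.0–H.1 (arXiv p. 7, L57–59 and L152–160)] [cite: MazurRubinMemoirs2004, Lemma 3.5.4] -/
theorem exists_eq_pow_smul_of_forall_sub_eq_pow_smul (π : R) {ι : Type*} (γ : ι → V → V)
    (hγ : ∀ i (r : R) (v : V), γ i (r • v) = r • γ i v)
    (hF : ∀ y : V, (∀ i, ∃ z, γ i y - y = π • z) → ∃ y', y = π • y')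
    (d : ℕ) (hK : ∀ i < d, ∀ z : V, π ^ i • z = 0 → ∃ z', z = π • z') :
    ∀ (n : ℕ), n ≤ d → ∀ x : V, (∀ i, ∃ w, γ i x - x = π ^ n • w) → ∃ y, x = π ^ n • y := by
  intro n
  induction n with
  | zero => exact fun _ x _ => ⟨x, by rw [pow_zero, one_smul]⟩
  | succ n ih =>
    intro hn x hx
    obtain ⟨u, rfl⟩ := ih (Nat.le_of_succ_le hn) x fun i => by
      obtain ⟨w, hw⟩ := hx i
      exact ⟨π • w, by rw [hw, pow_succ, mul_smul]⟩
    obtain ⟨u', hu'⟩ := hF u fun i => by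
      obtain ⟨w, hw⟩ := hx i
      rw [hγ, ← smul_sub, pow_succ, mul_smul] at hw
      have h0 : π ^ n • (γ i u - u - π • w) = 0 := by rw [smul_sub, hw, sub_self]
      obtain ⟨z', hz'⟩ := hK n (Nat.lt_of_succ_le hn) _ h0
      exact ⟨w + z', by rw [smul_add, ← hz', add_sub_cancel]⟩
    exact ⟨u', by rw [hu', pow_succ, mul_smul]⟩

end Devissage

/-! ## §2 Arithmetic of the level rings `R_j = R/𝔪^{e_j}` and of free `R_j`-modules -/

section Level

variable {R A V : Type*} [CommRing R] [CommRing A] [Algebra R A]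
  [AddCommGroup V] [Module A V] [Module R V] [IsScalarTower R A V]

/-- **Arithmetic of the level ring `R_j`**: if `R → A` is onto with kernel inside `(π^e)` (`A = R/𝔪^{e_j}`,
`𝔪 = (π)`, `R` a domain), then `π^i a = 0` with `i ≤ e` forces `a ∈ π^{e-i} A`. [cite: Howard2004HeegnerKolyvagin, Lemma 1.3.3 and H.0–H.1 (arXiv p. 7, L57–59 and L152–160)] -/
theorem exists_eq_pow_mul_of_pow_mul_eq_zero [IsDomain R] (π : R) (hπ0 : π ≠ 0) (e : ℕ)
    (hsurj : Function.Surjective (algebraMap R A))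
    (hker : RingHom.ker (algebraMap R A) ≤ Ideal.span {π ^ e}) {i : ℕ} (hi : i ≤ e) (a : A)
    (ha : algebraMap R A π ^ i * a = 0) : ∃ a', a = algebraMap R A π ^ (e - i) * a' := by
  obtain ⟨r, rfl⟩ := hsurj a
  have hmem : π ^ i * r ∈ RingHom.ker (algebraMap R A) := by
    rw [RingHom.mem_ker, map_mul, map_pow, ha]
  have hdvd : π ^ e ∣ π ^ i * r := Ideal.mem_span_singleton.1 (hker hmem)
  rw [← Nat.add_sub_cancel' hi, pow_add] at hdvd
  obtain ⟨r', rfl⟩ := (mul_dvd_mul_iff_left (pow_ne_zero i hπ0)).1 hdvd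
  exact ⟨algebraMap R A r', by rw [map_mul, map_pow]⟩

/-- **The same on a free `A`-module** (H.0: the level `T^{(j)}` is free over `R_j`): `π^i v = 0` with `i ≤ e`
forces `v ∈ π^{e-i} V` (coordinates in any basis). [cite: Howard2004HeegnerKolyvagin, Lemma 1.3.3 and H.0–H.1 (arXiv p. 7, L57–59 and L152–160)] -/
theorem exists_eq_pow_smul_of_pow_smul_eq_zero [IsDomain R] [Module.Free A V] (π : R) (hπ0 : π ≠ 0) (e : ℕ)
    (hsurj : Function.Surjective (algebraMap R A))
    (hker : RingHom.ker (algebraMap R A) ≤ Ideal.span {π ^ e}) {i : ℕ} (hi : i ≤ e) (v : V)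
    (hv : π ^ i • v = 0) : ∃ v', v = π ^ (e - i) • v' := by
  classical
  let b := Module.Free.chooseBasis A V
  set ϖ : A := algebraMap R A π with hϖ
  have hcoord : ∀ t, ∃ c, b.repr v t = ϖ ^ (e - i) * c := fun t => by
    refine exists_eq_pow_mul_of_pow_mul_eq_zero π hπ0 e hsurj hker hi _ ?_
    have h := congrArg (fun w => b.repr w t) hv
    simp only [map_zero, Finsupp.coe_zero, Pi.zero_apply] at h
    rw [← algebraMap_smul A (π ^ i) v, map_pow, map_smul, Finsupp.smul_apply, smul_eq_mul] at h
    exact h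
  choose c hc using hcoord
  have hmem : v ∈ (ϖ ^ (e - i)) • (⊤ : Submodule A V) := by
    rw [← b.linearCombination_repr v, Finsupp.linearCombination_apply, Finsupp.sum]
    refine Submodule.sum_mem _ fun t _ => ?_
    rw [hc t, mul_smul]
    exact Submodule.smul_mem_pointwise_smul (c t • b t) (ϖ ^ (e - i)) ⊤ Submodule.mem_top
  obtain ⟨w, -, hw⟩ := (Submodule.mem_smul_pointwise_iff_exists _ _ _).1 hmem
  exact ⟨w, by rw [← hw, hϖ, ← map_pow, algebraMap_smul]⟩

/-- The image of `π` in a nontrivial `A` killing `π^e` is not a unit. [cite: Howard2004HeegnerKolyvagin, Lemma 1.3.3 and H.0–H.1 (arXiv p. 7, L57–59 and L152–160)] -/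
theorem algebraMap_mem_nonunits [Nontrivial A] (π : R) (e : ℕ)
    (hker : π ^ e ∈ RingHom.ker (algebraMap R A)) : ¬ IsUnit (algebraMap R A π) := by
  intro hu
  have h := (hu.pow e).ne_zero
  rw [← map_pow] at h
  exact h ((RingHom.mem_ker).1 hker)

/-- **`𝔪_A · V ⊆ π V`** for `A` local, `R → A` onto and every non-unit of `R` divisible by `π` (`𝔪_R = (π)`):
the maximal ideal of the level ring is generated by the image of the uniformizer. [cite: Howard2004HeegnerKolyvagin, Lemma 1.3.3 and H.0–H.1 (arXiv p. 7, L57–59 and L152–160)] -/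
theorem exists_eq_smul_of_mem_maximalIdeal_smul [IsLocalRing A] (π : R)
    (hsurj : Function.Surjective (algebraMap R A))
    (hunif : ∀ r : R, ¬ IsUnit r → π ∣ r) {v : V}
    (hv : v ∈ (IsLocalRing.maximalIdeal A) • (⊤ : Submodule A V)) : ∃ v', v = π • v' := by
  have hle : (IsLocalRing.maximalIdeal A) • (⊤ : Submodule A V) ≤
      (algebraMap R A π) • (⊤ : Submodule A V) := by
    refine Submodule.smul_le.2 fun a ha n _ => ?_
    obtain ⟨r, rfl⟩ := hsurj a
    have hr : ¬ IsUnit r := fun hr => (IsLocalRing.mem_maximalIdeal _).1 ha (hr.map _)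
    obtain ⟨r', rfl⟩ := hunif r hr
    rw [map_mul, mul_smul]
    exact Submodule.smul_mem_pointwise_smul _ (algebraMap R A π) ⊤ Submodule.mem_top
  obtain ⟨w, -, hw⟩ := (Submodule.mem_smul_pointwise_iff_exists _ _ _).1 (hle hv)
  exact ⟨w, by rw [← hw, algebraMap_smul]⟩

end Level

/-! ## §3 `T̄^{Γ_K} = 0` from H.0 and H.1 -/

section Residual

variable {A V Nbar : Type*} [CommRing A] [AddCommGroup V] [Module A V]
  [AddCommGroup Nbar] [Module A Nbar]

/-- Coordinates, in a basis, of an element of `I • V` lie in `I` (a `private` copy of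
`Literature.RingTheory.Derivation.repr_mem_of_mem_smul_top` of `ResidueJacobianOne.lean`, to keep the
imports of the Howard directory light). [cite: Howard2004HeegnerKolyvagin, Lemma 1.3.3 and H.0–H.1 (arXiv p. 7, L57–59 and L152–160)] -/
private theorem repr_mem_of_mem_smul_top {ι : Type*} (b : Module.Basis ι A V) (I : Ideal A) {z : V}
    (hz : z ∈ I • (⊤ : Submodule A V)) (t : ι) : b.repr z t ∈ I := by
  have hle : I • (⊤ : Submodule A V) ≤ (Submodule.restrictScalars A I).comap (b.coord t) :=
    Submodule.smul_le.2 fun r hr n _ => by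
      simp only [Submodule.mem_comap, map_smul, smul_eq_mul, Submodule.restrictScalars_mem]
      exact I.mul_mem_right _ hr
  exact hle hz

/-- **`T̄^{Γ_K} = 0` from H.0 and H.1.**  Let `A` be local, `V` free of rank two over `A` (H.0), and
`π̄ : V ↠ N̄` an `A`-linear presentation of `V/𝔪V` (kernel `𝔪V`) carrying `A`-homogeneous operators `γ_i`
with NO proper non-zero stable `A`-submodule (H.1, irreducibility clause).  Then the `γ_i` have no common
non-zero fixed vector: a fixed `x ≠ 0` spans a stable line, so `N̄ = A·x` would be cyclic, whereas
`V/𝔪V ≅ (A/𝔪)²` is not (in a basis `b₀, b₁` of `V`: `π̄ bₜ = aₜ x` with `a₁ b₀ - a₀ b₁ ∈ ker π̄ = 𝔪V`, so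
`a₀, a₁ ∈ 𝔪`, so `π̄ = 0`, so `x = 0`). [cite: Howard2004HeegnerKolyvagin, Lemma 1.3.3 and H.0–H.1 (arXiv p. 7, L57–59 and L152–160)] -/
theorem residual_fixed_eq_zero [IsLocalRing A] [Module.Free A V] (h2 : Module.finrank A V = 2)
    (πbar : V →ₗ[A] Nbar) (hsurj : Function.Surjective πbar)
    (hker : LinearMap.ker πbar = (IsLocalRing.maximalIdeal A) • (⊤ : Submodule A V))
    {ι : Type*} (γ : ι → Nbar → Nbar) (hγ : ∀ i (a : A) (x : Nbar), γ i (a • x) = a • γ i x)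
    (hirr : ∀ W : Submodule A Nbar, (∀ i, ∀ x ∈ W, γ i x ∈ W) → W = ⊥ ∨ W = ⊤)
    (x : Nbar) (hx : ∀ i, γ i x = x) : x = 0 := by
  by_contra hx0
  have hW : ∀ i, ∀ w ∈ (A ∙ x), γ i w ∈ (A ∙ x) := fun i w hw => by
    obtain ⟨a, rfl⟩ := Submodule.mem_span_singleton.1 hw
    rw [hγ, hx]
    exact Submodule.smul_mem _ _ (Submodule.mem_span_singleton_self x)
  rcases hirr _ hW with hbot | htop
  · exact hx0 ((Submodule.span_singleton_eq_bot).1 hbot)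
  haveI : Module.Finite A V := Module.finite_of_finrank_eq_succ h2
  let b := Module.finBasisOfFinrankEq A V h2
  have hkill : ∀ a ∈ IsLocalRing.maximalIdeal A, a • x = 0 := fun a ha => by
    obtain ⟨m, rfl⟩ := hsurj x
    rw [← map_smul, ← LinearMap.mem_ker, hker]
    exact Submodule.smul_mem_smul ha Submodule.mem_top
  obtain ⟨a₀, ha₀⟩ := Submodule.mem_span_singleton.1 (htop ▸ Submodule.mem_top : πbar (b 0) ∈ A ∙ x)
  obtain ⟨a₁, ha₁⟩ := Submodule.mem_span_singleton.1 (htop ▸ Submodule.mem_top : πbar (b 1) ∈ A ∙ x)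
  have hz : a₁ • b 0 - a₀ • b 1 ∈ (IsLocalRing.maximalIdeal A) • (⊤ : Submodule A V) := by
    rw [← hker, LinearMap.mem_ker, map_sub, map_smul, map_smul, ← ha₀, ← ha₁, smul_smul, smul_smul,
      mul_comm, sub_self]
  have h1 : a₁ ∈ IsLocalRing.maximalIdeal A := by
    simpa [b.repr_self, Finsupp.single_apply] using repr_mem_of_mem_smul_top b _ hz 0
  have h0 : a₀ ∈ IsLocalRing.maximalIdeal A := by
    simpa [b.repr_self, Finsupp.single_apply] using repr_mem_of_mem_smul_top b _ hz 1
  have hb0 : πbar (b 0) = 0 := by rw [← ha₀, hkill a₀ h0]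
  have hb1 : πbar (b 1) = 0 := by rw [← ha₁, hkill a₁ h1]
  have hπ0 : πbar = 0 := b.ext fun t => by
    fin_cases t
    · exact hb0
    · exact hb1
  obtain ⟨m, rfl⟩ := hsurj x
  exact hx0 (by rw [hπ0, LinearMap.zero_apply])

end Residual

end Literature.NumberTheory.GaloisCohomology.Howard2004.LevelRaising

end
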